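/- Copyright: the b2b-balaban cell (near-miss cell 7), T⁴-continuum fan-out; row NE7b CRUX team (2), seat
t4-ne7b-formalise-leaf-02 (gen 25; the row owner's INTERFACE REQUEST NE7b IR-42-2 of ruling R-OWNER-42-2 «M5's cost side
is stated in TOTAL (lifeCost) form», `CLAIMS.log` l.29149, E-side part (E5T) — the repaired pinned END over the
memory-agnostic carrier with the realised-cost binders READ IN TOTAL FORM).  Released under the licence of the surrounding
project. -/
import Summits.QuantumFields.BalabanUV.T4Continuum.Support.HistoryRealiseCellsRunMultEndPDWT
import Summits.QuantumFields.BalabanUV.T4Continuum.Support.HistoryRealiseCellsRunPinnedT3bP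

/-!
# Realised histories: THE REPAIRED END v3.1 UNDER THE TWO PINS, MEMORY-AGNOSTIC CARRIER, COST SIDE IN TOTAL FORM
(`…RunW_pinnedT3bPDT`; INTERFACE REQUEST NE7b IR-42-2, E-side, file E5T)

Summits-side support leaf of the T⁴-continuum cell (rung (B)+1 on a FINITE torus only; NOT infinite volume, NOT the
mass gap, NOT the Clay statement; NOT a proof of the spine estimate NE7b, which is the cell's OWN estimate, NOT PRINTED
and NOT PROVED).  Row NE7b, route «COUNT» ∕ R-P1, re-open object (α); row S12-W of
`t4/b2b-balaban-t4-ne7b-p1/LEAVES-NE7b.md`; the owner's IR-42-2 (`CLAIMS.log` l.29149, `HOME/INBOX.md` l.4594–4598) as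
split by the S12-W custodian leaf-03 (`CLAIMS.log` l.29200: W-files → leaf-03, E-files → leaf-02): E5T = the total-form
twin of this seat's E5 `HistoryRealiseCellsRunPinnedT3bPW` (p255321) — the END on THE headline path.

WHY.  Ruling R-OWNER-42-2 (READING OF RECORD, kernel, by name): the END consumes the two H3 realised-cost binders
`hκ hκ' : ∀ … q ∈ memOf …, ∀ m ∈ life (padW (dictWT Prod.fst (R K) C.n₁) 0) q.2, κ K q q.2 m ≤ costT Prod.fst C K (R K) q.2 m`
ONLY through `lifeCostT_mono h = Finset.sum_le_sum h` (on the Mult road inside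
`HistoryAssemblyMultProfile.card_mul_pshapeTH_le_priceT_of_profile` → `pshapeTH_mul_exp_le_shapeTH_of_profile`, leaf-03's
located plumbing fact l.29200), so the TOTAL form
`lifeCost (padW (dictWT Prod.fst (R K) C.n₁) 0) (κ K q) q.2 ≤ lifeCost (padW (dictWT Prod.fst (R K) C.n₁) 0) (costT Prod.fst C K (R K)) q.2`
is a drop-in WEAKER binder with the same consequence; the owner's located design observation O-M5-1 (merger cascades)
is why the (α) brick M5-1 will supply the total and not the stepwise form.  THIS FILE re-plugs E5's repaired pinned END
accordingly, over leaf-03's total-form W-END of record v3.1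
`HistoryRealiseCellsRunMultEndPDWT.hybridNE7_of_realisedDomainsRunW_printedT3bPDT` (IR-42-2 W-side, W9T): statement =
E5's with the two cost binders in total form (the ONLY change), proof = E5's with `…RunW_printedT3bPD ↦ …RunW_printedT3bPDT`;
the thresholds (`γ₁`, `g₁ := min (min 1 (exp (−irThresholdTLE ∕ 2))) (exp (−(x_Θ + 1) ∕ 2))`, `Em`) and the by-name
discharges (`HistoryFlow.flowSide_of_betaPertHyp`, `HistoryFlowProfileLevel.thresholdPaid_of_coupling`,
`HistoryRealiseCellsRunPinned.beta0_le_of_L_mul_le` ∕ `…le_log_inv_sq_of_le_exp` ∕ `…four_le_L` — all carrier- and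
cost-free) are UNCHANGED; the conclusion is BYTE-IDENTICAL.  E5 stays (and follows from this file by `lifeCostT_mono` at
the two binders).  Append-only: nothing landed is edited.

WHAT.  **`hybridNE7_of_realisedDomainsRunW_pinnedT3bPDT`**.  [folklore] composition by name; no `def`, no `[cite:]` tag,
nothing printed asserted, no `Prop` fact minted (c1), zero `sorry`.  DISPLAYED: exactly as in the landed file (the module
docstring of `HistoryRealiseCellsRunPinnedT3bP`), with H3 in its W-form and its cost side in total form.

HONEST.  END v3.1 re-quantified (a by-name WEAKENING of two displayed H3 binders of OUR bookkeeping; class R of the cost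
reading UNCHANGED until the owner's M5-1 discharges it), not a new estimate; H3^NE7b (W-form), (B) and the
BetaPertH-flow facts stay DISPLAYED ∕ pinned BY NAME; by-name class of every `WALL-NE7b-P1.md` §2 binder UNCHANGED;
headline p224237 and the W-headline E8 (p255842) UNCHANGED BY NAME; NE7b NOT proved; spine 0∕9.  HONEST DEPENDENCY
(cell): continuum YM on T⁴ ⇐ BetaPertH ∧ nine spine estimates (0/9 proved); BetaPertH ⇐ (D1) ∧ (D4) ∧ CAP+tail; G-an2-4
gates asym, D1 and NE2/3/4.  This file changes none of it. -/

open Finset MeasureTheory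
open Literature.MathematicalPhysics.QuantumFieldTheory.Balaban1983to89
open T4PersistenceDictionary T4PersistentHistoryCount T4BankedInduction T4PrintedShapeBanking
open T4WeightBudget T4GlobalDenominator T4LiveClassFibration T4LiveStructureGas T4LiveGasToTerms T4RecordPriceSeam
open T4PartnerMultiplicity T4IndicatorShell T4MatchingAssembly T4MatchingClosure T4MatchingClosureSocket T4Continuum
open T4StabilitySocket T4BranchingRecordsGas T4TaggedShapeBanking T4CanonicalMenus T4RenewalChains
open Summit.QuantumFields.BalabanUV.T4Continuum.PlacementBatch Summit.QuantumFields.BalabanUV.T4Continuum.PlacementSkeleton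
open Summit.QuantumFields.BalabanUV.T4Continuum.CountThresholdUniform Summit.QuantumFields.BalabanUV.T4Continuum.CountThresholdExit
open Summit.QuantumFields.BalabanUV.T4Continuum.CountSeamJunction Summit.QuantumFields.BalabanUV.T4Continuum.LateMergers
open Summit.QuantumFields.BalabanUV.T4Continuum.HistoryFlow Summit.QuantumFields.BalabanUV.T4Continuum.HistoryRegeneration
open Summit.QuantumFields.BalabanUV.T4Continuum.HistoryTables Summit.QuantumFields.BalabanUV.T4Continuum.HistoryAssemblyTrees
open Summit.QuantumFields.BalabanUV.T4Continuum.HistoryAssemblyTerms Summit.QuantumFields.BalabanUV.T4Continuum.HistoryAssemblyPedigree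
open Summit.QuantumFields.BalabanUV.T4Continuum.HistoryConstants Summit.QuantumFields.BalabanUV.T4Continuum.HistoryGen
open Literature.MathematicalPhysics.QuantumFieldTheory.Balaban1983to89.B13ScaleTransfer
open Summit.QuantumFields.BalabanUV.T4Continuum.ZoneSkeleton Summit.QuantumFields.BalabanUV.T4Continuum.HistorySocketTH
open Summit.QuantumFields.BalabanUV.T4Continuum.HistoryCaps Summit.QuantumFields.BalabanUV.T4Continuum.HistoryAssemblyPrice
open Summit.QuantumFields.BalabanUV.T4Continuum.HistoryBankingLE Summit.QuantumFields.BalabanUV.T4Continuum.HistoryExitLE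
open Summit.QuantumFields.BalabanUV.T4Continuum.HistoryAssemblyTreesLE Summit.QuantumFields.BalabanUV.T4Continuum.HistoryAssemblyTermsLE
open Summit.QuantumFields.BalabanUV.T4Continuum.HistoryRealise Summit.QuantumFields.BalabanUV.T4Continuum.HistoryAssemblyRealiseLE
open Summit.QuantumFields.BalabanUV.T4Continuum.HistoryAssemblyMult Summit.QuantumFields.BalabanUV.T4Continuum.HistoryAssemblyMultKey
open Summit.QuantumFields.BalabanUV.T4Continuum.HistoryAssemblyRealiseRun Summit.QuantumFields.BalabanUV.T4Continuum.HistoryAssemblyRealiseMult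
open Summit.QuantumFields.BalabanUV.T4Continuum.HistoryZones Summit.QuantumFields.BalabanUV.T4Continuum.HistoryRealiseCells
open Summit.QuantumFields.BalabanUV.T4Continuum.HistoryRealiseCellsRun Summit.QuantumFields.BalabanUV.T4Continuum.HistoryAssemblyRealiseRunMult
open Summit.QuantumFields.BalabanUV.T4Continuum.HistoryRealiseCellsRunMult Summit.QuantumFields.BalabanUV.T4Continuum.HistoryAssemblyMultInstance
open Summit.QuantumFields.BalabanUV.T4Continuum.HistoryJoinsPlacedMember Summit.QuantumFields.BalabanUV.T4Continuum.PlacementSkeleton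
open Summit.QuantumFields.BalabanUV.T4Continuum.HistoryJoinsPlacedMult Summit.QuantumFields.BalabanUV.T4Continuum.HistoryRealiseDistinct
open Summit.QuantumFields.BalabanUV.T4Continuum.HistoryRegionTemplates Summit.QuantumFields.BalabanUV.T4Continuum.HistoryCaps
open Summit.QuantumFields.BalabanUV.T4Continuum.HistoryZoneEvolve (cth)
open Literature.MathematicalPhysics.QuantumFieldTheory.Balaban1983to89.B16SProfile (DropCtl)
open Summit.QuantumFields.BalabanUV.T4Continuum.HistoryRealiseCellsRunMultEnd Summit.QuantumFields.BalabanUV.T4Continuum.HistoryRealiseCellsRunMultP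
open Summit.QuantumFields.BalabanUV.T4Continuum.HistoryRealiseCellsRunMultEndP
open Summit.QuantumFields.BalabanUV.T4Continuum.HistoryRealiseCellsRunMultEndPD

open Summit.QuantumFields.BalabanUV.T4Continuum.HistoryRealisePrint Summit.QuantumFields.BalabanUV.T4Continuum.HistoryRealiseWeak
open Summit.QuantumFields.BalabanUV.T4Continuum.HistoryRealisePrintReading Summit.QuantumFields.BalabanUV.T4Continuum.HistoryRealiseWeakReading
open Summit.QuantumFields.BalabanUV.T4Continuum.HistoryRealisePrintCells Summit.QuantumFields.BalabanUV.T4Continuum.HistoryRealiseWeakCells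
open Summit.QuantumFields.BalabanUV.T4Continuum.HistoryRealiseCellsRunPinnedT3bP
open Summit.QuantumFields.BalabanUV.T4Continuum.HistoryRealiseCellsRunMultEndPDWT
namespace Summit.QuantumFields.BalabanUV.T4Continuum.HistoryRealiseCellsRunPinnedT3bPWT

noncomputable section

universe u v w

section Pinned

variable {F : T4Family} {G : Type*} [GaugeGroup G] [MeasurableSpace G] [HaarData G] [RegularGaugeGroup G]

/-- **NE7b's COUNT EXIT — THE REPAIRED END v3.1 OVER THE MEMORY-AGNOSTIC CARRIER, COST SIDE IN TOTAL FORM, UNDER THE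
PINS `(B)` AND `BetaPertHyp`, THE MULTIPLICITY'S LEVEL PAID BY THE COUPLING THRESHOLD** (total-form twin: E5's
`hybridNE7_of_realisedDomainsRunW_pinnedT3bPD` VERBATIM with the two H3 realised-cost binders read as
`lifeCost (padW (dictWT Prod.fst (R K) C.n₁) 0) (κ K q) q.2 ≤ lifeCost (padW …) (costT Prod.fst C K (R K)) q.2` (R-OWNER-42-2)
and leaf-03's W9T END `hybridNE7_of_realisedDomainsRunW_printedT3bPDT`; thresholds, discharges and the conclusion
BYTE-IDENTICAL).  The flow binders `hb hlo hhi hγ hγβ S` (+ `hp₀ hrr hβ`) DISCHARGED from `hβ : BetaPertHyp D.βfun`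
(`HistoryFlow.flowSide_of_betaPertHyp` at the exponent `max C.p₀ rr`); the (B)-side witness `hcor` + `γ ≤ γB` DISCHARGED
from the pin `hB : B16.EndStatementBPrinted D.C`; the infrared clause `hir` AND THE LEVEL `hP1 : 1 ≤ P`,
`hP : ∀ K ≥ K₀, ∀ s ≤ K, P ≤ p0Profile C.A₀ C.p₀ (g_K s)`, `hθJ : Θ ≤ θ·P` DISCHARGED on `]0, g₁]`,
`g₁ := min (min 1 (exp (−irThresholdTLE C F.L rr β₀ ∕ 2))) (exp (−(x_Θ + 1) ∕ 2))`, `x_Θ := max 1 (Θ ∕ (θ·C.A₀))`,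
`P := C.A₀·x_Θ^{C.p₀}` (`HistoryFlowProfileLevel.thresholdPaid_of_coupling` BY NAME); `4 ≤ F.L`, `β₀ ≤ ½` as in E4T.
Constants-side binders in front of the prefix ALL INHABITED by O(1) constants (`exists_consts_countRoadT3bP`); no `hθJ`,
no demand.  Everything after `D.Tuned γ g g₀ →` is the total-form END v3.1's binder list verbatim minus `hP1 hP hθJ`;
conclusion = END v3.1's with `max (em g) 0 ↦ Em`.  NE7b NOT proved. [folklore] -/
theorem hybridNE7_of_realisedDomainsRunW_pinnedT3bPDT (D : FiniteEpsData F G)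
    -- the two pins, BY NAME, and the sign conventions of the datum
    (hB : B16.EndStatementBPrinted D.C) (hβ : BetaPertHyp D.βfun) (hsign : B16.SignConventions D.C)
    -- the constants (symbolic, c2∕c6) and their side conditions; NO `Dominates` on the slack road
    {C : T4PrintedShapeBanking.Consts} {O : PrintedO1s}
    {rr : ℕ} {β₀ : ℝ} (h : ThresholdOK C F.L rr β₀) (hμ : 0 < C.μ) (d n : ℕ)
    (hκ₁ : (d : ℝ) * Real.log F.L + 2 * Real.log 2 ≤ C.κ₁) (hE₀ : Real.log (2 + birthMass C) ≤ C.E₀)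
    (hA₀ : 1 ≤ C.A₀) (hβ₀ : 0 < β₀) (hLβ : (F.L : ℝ) * β₀ ≤ 1) (hn₁ : 13 ≤ C.n₁) (hn : 0 < n)
    -- the class-linear slack for ANY POSITIVE `θ` (the level `P` with `hθJ : … ≤ θ·P` and the profile clause `hP` are
    -- DISCHARGED from the coupling threshold), and row S6g′'s instance: stride `sS`, decay `θc`, arithmetic, signs
    {θ : ℝ} (hθ : 0 < θ) (hslack : C.a + θ ≤ O.γ₀ * O.A₁ ^ 2 / 2)
    (hE₂ : 0 < C.E₂) (hE₃ : 0 ≤ C.E₃) {sS : ℕ} (hsS : 1 ≤ sS)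
    (hsmall : (((2 * cth 32 1 sS + 1) ^ d : ℕ) : ℝ) * (5 : ℝ) ^ d * ((max 1 (2 * 32 + 2) : ℕ) : ℝ) ≤
      (F.L : ℝ) ^ (sS / 2) / 2)
    {θc : ℝ} (hθc0 : 0 ≤ θc) (hθc1 : θc < 1) (hθcs : 1 / 2 ≤ θc ^ sS) :
    ∃ γ₁ : ℝ, 0 < γ₁ ∧ ∀ γ : ℝ, 0 < γ → γ ≤ γ₁ → ∃ g₁ : ℝ, 0 < g₁ ∧ ∀ g : ℝ, 0 < g → g ≤ g₁ →
      ∃ Em : ℝ, 0 ≤ Em ∧ ∀ g₀ : ℕ → ℝ, D.Tuned γ g g₀ →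
      ∀ {ι : Type u} [DecidableEq ι] {α : Type v} {π : Type w} [DecidableEq α] [DecidableEq π]
        (l₀ vol : ℝ) (K₀ : ℕ) (T : ℕ → Finset ι) (A A' shA shB dead dead' : ℕ → ℝ → ι → ℝ)
        (nup mup : ℕ → ℝ → ℝ) (Nup : ℝ) (Cc Rr CcRec RrRec : ℕ → ℝ → ι → ℝ) (ν u s₂ q₀ r s Wsh : ℕ → ℝ)
        -- the observable and the two runs' (α) integral bounds, floors, site budgets, envelopes ((B) side, displayed)
        (obs : (K : ℕ) → GaugeField (F.P K) 0 G → ℝ) (B : ℝ),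
        (∀ K, Measurable (obs K)) →
        (∀ K U, |obs K U| ≤ B) →
        (∀ K t, |t| ≤ l₀ → K₀ ≤ K →
          ∫ U, Real.exp (t * obs K U) * D.dens K (g₀ K) 0 U ∂fieldMeasure (F.P K) 0 G ≤ ∑ τ ∈ T K, A K t τ) →
        (∀ K t, |t| ≤ l₀ → K₀ ≤ K →
          ∫ U, Real.exp (t * obs (K + 1) U) * D.dens (K + 1) (g₀ (K + 1)) 0 U ∂fieldMeasure (F.P (K + 1)) 0 G ≤
          ∑ τ ∈ T K, A' K t τ) →
      ∀ (c₀ n₁ : ℝ),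
        0 < c₀ →
        (∀ K, K₀ ≤ K → c₀ ≤ smallFieldMass D K (g₀ K)) →
        (∀ K, K₀ ≤ K → c₀ ≤ smallFieldMass D (K + 1) (g₀ (K + 1))) →
        (∀ K, K₀ ≤ K → ((D.C ⟨K, F.m, g₀ K⟩).numSites K : ℝ) ≤ n₁) →
        (∀ K, K₀ ≤ K → ((D.C ⟨K + 1, F.m, g₀ (K + 1)⟩).numSites (K + 1) : ℝ) ≤ n₁) →
        0 ≤ Nup →
        (∀ K t, |t| ≤ l₀ → K₀ ≤ K → 0 ≤ nup K t ∧ nup K t ≤ Nup) →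
        (∀ K t, |t| ≤ l₀ → K₀ ≤ K → 0 ≤ mup K t ∧ mup K t ≤ Nup) →
      -- the (2.5) side condition on the size function
      ∀ (R : ℕ → ℕ → ℕ),
        (∀ K s, s ≤ K → B14.IsRj F.L rr ((D.C ⟨K, F.m, g₀ K⟩).flow.g s) (R K s)) →
        (∀ K, K₀ ≤ K → ∀ t, 1 ≤ R K t) →
      -- H3: the terms read as pedigrees REALISED BY THE RUN'S OWN PROFILE with their DOMAINS
      ∀ (ped : ℕ → ι → Pedigree α π) (cellP : ℕ → ι → π → Pt d × Finset (Pt d)) (liveC : ℕ → ι → Finset α) (Zd : ℕ → ι → α → Finset (Pt d)),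
        RealisedDomainsRW F.L (runProfile F.L R) n K₀ R T ped cellP liveC Zd →
      -- H3: live components dated no later than the cutoff; the constituents' reading clauses
        (∀ K, K₀ ≤ K → ∀ τ ∈ T K, ∀ c ∈ liveC K τ, (ped K τ).step c ≤ K) →
        (∀ K, K₀ ≤ K → ∀ τ ∈ T K, ∀ c ∈ liveC K τ, DisjointJoins ((ped K τ).toPGen (cellP K τ) c)) →
        (∀ K, K₀ ≤ K → ∀ τ ∈ T K, ∀ c ∈ liveC K τ,
          BoxedBirths n F.L K (levelOf (runProfile F.L R K) K) ((ped K τ).toPGen (cellP K τ) c)) →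
      -- H3: realised per-step costs of the live members; their LIFE cost read below the model's booked LIFE cost
      -- (TOTAL form, ruling R-OWNER-42-2 ∕ IR-42-2)
      ∀ (κ κ' : ℕ → (Fin d → ℕ) × Gen (Lab α π) → Gen (Lab α π) → ℕ → ℝ),
        (∀ K, K₀ ≤ K → ∀ τ ∈ badTerms (memOf ped liveC (cellOfR n F.L (runProfile F.L R) ped cellP)) jhalf T K, ∀ q ∈ memOf ped liveC (cellOfR n F.L (runProfile F.L R) ped cellP) K τ,
          lifeCost (padW (dictWT Prod.fst (R K) C.n₁) 0) (κ K q) q.2 ≤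
            lifeCost (padW (dictWT Prod.fst (R K) C.n₁) 0) (costT Prod.fst C K (R K)) q.2) →
        (∀ K, K₀ ≤ K → ∀ τ ∈ badTerms (memOf ped liveC (cellOfR n F.L (runProfile F.L R) ped cellP)) jhalf T K, ∀ q ∈ memOf ped liveC (cellOfR n F.L (runProfile F.L R) ped cellP) K τ,
          lifeCost (padW (dictWT Prod.fst (R K) C.n₁) 0) (κ' K q) q.2 ≤
            lifeCost (padW (dictWT Prod.fst (R K) C.n₁) 0) (costT Prod.fst C K (R K)) q.2) →
      -- H3: the per-term price sentence over the named members in PRINT's currency, discounted; both runs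
      ∀ (FcM RfM FcM' RfM' : ℕ → Finset ((Fin d → ℕ) × Gen PEv × Multiset (PEv × ((Fin d → ℕ) × Finset (Pt d)))) → ℝ),
        (∀ K t, |t| ≤ l₀ → K₀ ≤ K → ∀ τ ∈ badTerms (memOf ped liveC (cellOfR n F.L (runProfile F.L R) ped cellP)) jhalf T K,
          FcM K (kmemOf ped liveC (cellOfR n F.L (runProfile F.L R) ped cellP) (physV n F.L hn (Nat.lt_of_lt_of_le Nat.zero_lt_two (two_le_L F))
          (fun K => tcap d (dcapOf Prod.fst T (memOf ped liveC (cellOfR n F.L (runProfile F.L R) ped cellP)) K))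
          (fun K => one_le_tcap d (dcapOf Prod.fst T (memOf ped liveC (cellOfR n F.L (runProfile F.L R) ped cellP)) K)) (runProfile F.L R) ped cellP) K τ) * RfM K (kmemOf ped liveC (cellOfR n F.L (runProfile F.L R) ped cellP) (physV n F.L hn (Nat.lt_of_lt_of_le Nat.zero_lt_two (two_le_L F))
          (fun K => tcap d (dcapOf Prod.fst T (memOf ped liveC (cellOfR n F.L (runProfile F.L R) ped cellP)) K))
          (fun K => one_le_tcap d (dcapOf Prod.fst T (memOf ped liveC (cellOfR n F.L (runProfile F.L R) ped cellP)) K)) (runProfile F.L R) ped cellP) K τ) ≤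
          ∏ q ∈ memOf ped liveC (cellOfR n F.L (runProfile F.L R) ped cellP) K τ,
          pshapeTH Prod.fst O C 1 1 (R K) (D.C ⟨K, F.m, g₀ K⟩).flow.g 0 (κ K q) q.2 * Real.exp (-(8 / C.E₂ * totalCostT Prod.fst C K (R K) q.2 + 4 * (partnerAges (PEv.step ∘ Prod.fst) q.2 : ℝ)))) →
        (∀ K t, |t| ≤ l₀ → K₀ ≤ K → ∀ τ ∈ badTerms (memOf ped liveC (cellOfR n F.L (runProfile F.L R) ped cellP)) jhalf T K,
          FcM' K (kmemOf ped liveC (cellOfR n F.L (runProfile F.L R) ped cellP) (physV n F.L hn (Nat.lt_of_lt_of_le Nat.zero_lt_two (two_le_L F))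
          (fun K => tcap d (dcapOf Prod.fst T (memOf ped liveC (cellOfR n F.L (runProfile F.L R) ped cellP)) K))
          (fun K => one_le_tcap d (dcapOf Prod.fst T (memOf ped liveC (cellOfR n F.L (runProfile F.L R) ped cellP)) K)) (runProfile F.L R) ped cellP) K τ) * RfM' K (kmemOf ped liveC (cellOfR n F.L (runProfile F.L R) ped cellP) (physV n F.L hn (Nat.lt_of_lt_of_le Nat.zero_lt_two (two_le_L F))
          (fun K => tcap d (dcapOf Prod.fst T (memOf ped liveC (cellOfR n F.L (runProfile F.L R) ped cellP)) K))
          (fun K => one_le_tcap d (dcapOf Prod.fst T (memOf ped liveC (cellOfR n F.L (runProfile F.L R) ped cellP)) K)) (runProfile F.L R) ped cellP) K τ) ≤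
          ∏ q ∈ memOf ped liveC (cellOfR n F.L (runProfile F.L R) ped cellP) K τ,
          pshapeTH Prod.fst O C 1 1 (R K) (D.C ⟨K, F.m, g₀ K⟩).flow.g 0 (κ' K q) q.2 * Real.exp (-(8 / C.E₂ * totalCostT Prod.fst C K (R K) q.2 + 4 * (partnerAges (PEv.step ∘ Prod.fst) q.2 : ℝ)))) →
      -- H3: the remaining `Regeneration` numerator readings, over the PHYSICAL member families (run A, then run B)
        (∀ K t, |t| ≤ l₀ → K₀ ≤ K →
          ∀ k ∈ badGMems (memOf ped liveC (cellOfR n F.L (runProfile F.L R) ped cellP)) jhalf T (kmemOf ped liveC (cellOfR n F.L (runProfile F.L R) ped cellP) (physV n F.L hn (Nat.lt_of_lt_of_le Nat.zero_lt_two (two_le_L F))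
          (fun K => tcap d (dcapOf Prod.fst T (memOf ped liveC (cellOfR n F.L (runProfile F.L R) ped cellP)) K))
          (fun K => one_le_tcap d (dcapOf Prod.fst T (memOf ped liveC (cellOfR n F.L (runProfile F.L R) ped cellP)) K)) (runProfile F.L R) ped cellP)) K,
          ∀ τ ∈ fibre (kmemOf ped liveC (cellOfR n F.L (runProfile F.L R) ped cellP) (physV n F.L hn (Nat.lt_of_lt_of_le Nat.zero_lt_two (two_le_L F))
          (fun K => tcap d (dcapOf Prod.fst T (memOf ped liveC (cellOfR n F.L (runProfile F.L R) ped cellP)) K))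
          (fun K => one_le_tcap d (dcapOf Prod.fst T (memOf ped liveC (cellOfR n F.L (runProfile F.L R) ped cellP)) K)) (runProfile F.L R) ped cellP)) T K k, A K t τ ≤ dead K t τ * FcM K k * nup K t) →
        (∀ K t, |t| ≤ l₀ → K₀ ≤ K →
          ∀ k ∈ badGMems (memOf ped liveC (cellOfR n F.L (runProfile F.L R) ped cellP)) jhalf T (kmemOf ped liveC (cellOfR n F.L (runProfile F.L R) ped cellP) (physV n F.L hn (Nat.lt_of_lt_of_le Nat.zero_lt_two (two_le_L F))
          (fun K => tcap d (dcapOf Prod.fst T (memOf ped liveC (cellOfR n F.L (runProfile F.L R) ped cellP)) K))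
          (fun K => one_le_tcap d (dcapOf Prod.fst T (memOf ped liveC (cellOfR n F.L (runProfile F.L R) ped cellP)) K)) (runProfile F.L R) ped cellP)) K,
          ∀ τ ∈ fibre (kmemOf ped liveC (cellOfR n F.L (runProfile F.L R) ped cellP) (physV n F.L hn (Nat.lt_of_lt_of_le Nat.zero_lt_two (two_le_L F))
          (fun K => tcap d (dcapOf Prod.fst T (memOf ped liveC (cellOfR n F.L (runProfile F.L R) ped cellP)) K))
          (fun K => one_le_tcap d (dcapOf Prod.fst T (memOf ped liveC (cellOfR n F.L (runProfile F.L R) ped cellP)) K)) (runProfile F.L R) ped cellP)) T K k, 0 ≤ dead K t τ) →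
        (∀ K t, |t| ≤ l₀ → K₀ ≤ K →
          ∀ k ∈ badGMems (memOf ped liveC (cellOfR n F.L (runProfile F.L R) ped cellP)) jhalf T (kmemOf ped liveC (cellOfR n F.L (runProfile F.L R) ped cellP) (physV n F.L hn (Nat.lt_of_lt_of_le Nat.zero_lt_two (two_le_L F))
          (fun K => tcap d (dcapOf Prod.fst T (memOf ped liveC (cellOfR n F.L (runProfile F.L R) ped cellP)) K))
          (fun K => one_le_tcap d (dcapOf Prod.fst T (memOf ped liveC (cellOfR n F.L (runProfile F.L R) ped cellP)) K)) (runProfile F.L R) ped cellP)) K,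
          ∑ τ ∈ fibre (kmemOf ped liveC (cellOfR n F.L (runProfile F.L R) ped cellP) (physV n F.L hn (Nat.lt_of_lt_of_le Nat.zero_lt_two (two_le_L F))
          (fun K => tcap d (dcapOf Prod.fst T (memOf ped liveC (cellOfR n F.L (runProfile F.L R) ped cellP)) K))
          (fun K => one_le_tcap d (dcapOf Prod.fst T (memOf ped liveC (cellOfR n F.L (runProfile F.L R) ped cellP)) K)) (runProfile F.L R) ped cellP)) T K k, dead K t τ ≤ RfM K k) →
        (∀ K t, |t| ≤ l₀ → K₀ ≤ K →
          ∀ k ∈ badGMems (memOf ped liveC (cellOfR n F.L (runProfile F.L R) ped cellP)) jhalf T (kmemOf ped liveC (cellOfR n F.L (runProfile F.L R) ped cellP) (physV n F.L hn (Nat.lt_of_lt_of_le Nat.zero_lt_two (two_le_L F))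
          (fun K => tcap d (dcapOf Prod.fst T (memOf ped liveC (cellOfR n F.L (runProfile F.L R) ped cellP)) K))
          (fun K => one_le_tcap d (dcapOf Prod.fst T (memOf ped liveC (cellOfR n F.L (runProfile F.L R) ped cellP)) K)) (runProfile F.L R) ped cellP)) K, 0 ≤ FcM K k) →
        (∀ K t, |t| ≤ l₀ → K₀ ≤ K →
          ∀ k ∈ badGMems (memOf ped liveC (cellOfR n F.L (runProfile F.L R) ped cellP)) jhalf T (kmemOf ped liveC (cellOfR n F.L (runProfile F.L R) ped cellP) (physV n F.L hn (Nat.lt_of_lt_of_le Nat.zero_lt_two (two_le_L F))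
          (fun K => tcap d (dcapOf Prod.fst T (memOf ped liveC (cellOfR n F.L (runProfile F.L R) ped cellP)) K))
          (fun K => one_le_tcap d (dcapOf Prod.fst T (memOf ped liveC (cellOfR n F.L (runProfile F.L R) ped cellP)) K)) (runProfile F.L R) ped cellP)) K,
          ∀ τ ∈ fibre (kmemOf ped liveC (cellOfR n F.L (runProfile F.L R) ped cellP) (physV n F.L hn (Nat.lt_of_lt_of_le Nat.zero_lt_two (two_le_L F))
          (fun K => tcap d (dcapOf Prod.fst T (memOf ped liveC (cellOfR n F.L (runProfile F.L R) ped cellP)) K))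
          (fun K => one_le_tcap d (dcapOf Prod.fst T (memOf ped liveC (cellOfR n F.L (runProfile F.L R) ped cellP)) K)) (runProfile F.L R) ped cellP)) T K k, A' K t τ ≤ dead' K t τ * FcM' K k * mup K t) →
        (∀ K t, |t| ≤ l₀ → K₀ ≤ K →
          ∀ k ∈ badGMems (memOf ped liveC (cellOfR n F.L (runProfile F.L R) ped cellP)) jhalf T (kmemOf ped liveC (cellOfR n F.L (runProfile F.L R) ped cellP) (physV n F.L hn (Nat.lt_of_lt_of_le Nat.zero_lt_two (two_le_L F))
          (fun K => tcap d (dcapOf Prod.fst T (memOf ped liveC (cellOfR n F.L (runProfile F.L R) ped cellP)) K))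
          (fun K => one_le_tcap d (dcapOf Prod.fst T (memOf ped liveC (cellOfR n F.L (runProfile F.L R) ped cellP)) K)) (runProfile F.L R) ped cellP)) K,
          ∀ τ ∈ fibre (kmemOf ped liveC (cellOfR n F.L (runProfile F.L R) ped cellP) (physV n F.L hn (Nat.lt_of_lt_of_le Nat.zero_lt_two (two_le_L F))
          (fun K => tcap d (dcapOf Prod.fst T (memOf ped liveC (cellOfR n F.L (runProfile F.L R) ped cellP)) K))
          (fun K => one_le_tcap d (dcapOf Prod.fst T (memOf ped liveC (cellOfR n F.L (runProfile F.L R) ped cellP)) K)) (runProfile F.L R) ped cellP)) T K k, 0 ≤ dead' K t τ) →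
        (∀ K t, |t| ≤ l₀ → K₀ ≤ K →
          ∀ k ∈ badGMems (memOf ped liveC (cellOfR n F.L (runProfile F.L R) ped cellP)) jhalf T (kmemOf ped liveC (cellOfR n F.L (runProfile F.L R) ped cellP) (physV n F.L hn (Nat.lt_of_lt_of_le Nat.zero_lt_two (two_le_L F))
          (fun K => tcap d (dcapOf Prod.fst T (memOf ped liveC (cellOfR n F.L (runProfile F.L R) ped cellP)) K))
          (fun K => one_le_tcap d (dcapOf Prod.fst T (memOf ped liveC (cellOfR n F.L (runProfile F.L R) ped cellP)) K)) (runProfile F.L R) ped cellP)) K,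
          ∑ τ ∈ fibre (kmemOf ped liveC (cellOfR n F.L (runProfile F.L R) ped cellP) (physV n F.L hn (Nat.lt_of_lt_of_le Nat.zero_lt_two (two_le_L F))
          (fun K => tcap d (dcapOf Prod.fst T (memOf ped liveC (cellOfR n F.L (runProfile F.L R) ped cellP)) K))
          (fun K => one_le_tcap d (dcapOf Prod.fst T (memOf ped liveC (cellOfR n F.L (runProfile F.L R) ped cellP)) K)) (runProfile F.L R) ped cellP)) T K k, dead' K t τ ≤ RfM' K k) →
        (∀ K t, |t| ≤ l₀ → K₀ ≤ K →
          ∀ k ∈ badGMems (memOf ped liveC (cellOfR n F.L (runProfile F.L R) ped cellP)) jhalf T (kmemOf ped liveC (cellOfR n F.L (runProfile F.L R) ped cellP) (physV n F.L hn (Nat.lt_of_lt_of_le Nat.zero_lt_two (two_le_L F))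
          (fun K => tcap d (dcapOf Prod.fst T (memOf ped liveC (cellOfR n F.L (runProfile F.L R) ped cellP)) K))
          (fun K => one_le_tcap d (dcapOf Prod.fst T (memOf ped liveC (cellOfR n F.L (runProfile F.L R) ped cellP)) K)) (runProfile F.L R) ped cellP)) K, 0 ≤ FcM' K k) →
      -- the seam's other inputs: NE7c's shell weight bound, NE7's core budget, four summable rates
        ShellWeightBound l₀ T A A' shA shB Wsh →
        ReindexedBudget l₀ vol T (fun K t τ => A K t τ - shA K t τ) (fun K t τ => A' K t τ - shB K t τ)
          (badOfClass (bstrOf Prod.fst (memOf ped liveC (cellOfR n F.L (runProfile F.L R) ped cellP))) T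
          (fun K _ => badClasses Prod.fst (memOf ped liveC (cellOfR n F.L (runProfile F.L R) ped cellP)) jhalf T K)) Cc Rr CcRec RrRec ν u s₂ q₀ r s →
        Summable r →
        Summable u →
        Summable s →
        Summable s₂ →
    ∃ K₁ K₂, K₀ ≤ K₁ ∧ HybridNE7 l₀ vol (fun K => T (K₁ + (K₂ + K))) (fun K => A (K₁ + (K₂ + K)))
      (fun K => A' (K₁ + (K₂ + K)))
      (fun K => badOfClass (bstrOf Prod.fst (memOf ped liveC (cellOfR n F.L (runProfile F.L R) ped cellP))) T
        (fun K _ => badClasses Prod.fst (memOf ped liveC (cellOfR n F.L (runProfile F.L R) ped cellP)) jhalf T K) (K₁ + (K₂ + K)))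
      (fun K => constOf l₀ B Em n₁ c₀ Nup *
        recordsBudget (birthMass C) C.κ₁ ((n : ℝ) ^ d) ((F.L : ℝ) ^ d) (Real.log 2) jhalf (K₁ + (K₂ + K)))
      (fun K => shA (K₁ + (K₂ + K))) (fun K => shB (K₁ + (K₂ + K))) (fun K => Wsh (K₁ + (K₂ + K)))
      (fun K => (r (K₁ + (K₂ + K)) + u (K₁ + (K₂ + K))) + (s (K₁ + (K₂ + K)) + s₂ (K₁ + (K₂ + K)))) := by
  -- thresholds: the flow side from `BetaPertHyp`, the (B) side from the pin; the infrared clause AND THE LEVEL from `g₁`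
  obtain ⟨hβ₁, hβhalf⟩ := HistoryRealiseCellsRunPinned.beta0_le_of_L_mul_le (F := F) hLβ
  obtain ⟨γ₀, b, β', _hγ₀, hb, _hbβ, hlo, hhi, γf, hγf, hγf₀, hS⟩ :=
    flowSide_of_betaPertHyp D hβ hβ₀ hβ₁ hLβ (max C.p₀ rr)
  obtain ⟨γB, hγB, em, ep, hcor⟩ := hB.2
  refine ⟨min γf γB, lt_min hγf hγB, fun γ hγ hγle => ?_⟩
  obtain ⟨hSm, hγβ⟩ := hS γ hγ (hγle.trans (min_le_left _ _))
  -- row S6g′'s class-linear constant `Θ` (the left side of END v3.1's `hθJ`, verbatim), to be paid at the level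
  -- `P := C.A₀·x_Θ^(C.p₀)`, `x_Θ := max 1 (Θ ∕ (θ·C.A₀))`, below the coupling threshold `exp (−(x_Θ + 1) ∕ 2)`
  let Θ : ℝ := (2 +
      ((2 * (((2 * cth 32 1 sS + 1) ^ d : ℕ) : ℝ) * ((((2 * 32 + 1) ^ d : ℕ) : ℝ) * (4 * 2 ^ d)) +
      4 * ((((2 * cth 32 1 sS + 1) ^ d : ℕ) : ℝ) * (5 : ℝ) ^ d)) / (1 - θc) +
      2 * (2 * ((((2 * cth 32 1 sS + 1) ^ d : ℕ) : ℝ) * (5 : ℝ) ^ d))) +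
      (2 * ((0 + 2 * Real.log (2 * d + 1)) + (2 * (d : ℝ) + 2 * Real.log (2 * d + 1)) *
      (((max 1 (2 * 32 + 2) : ℕ) : ℝ) * (2 * ((((2 * cth 32 1 sS + 1) ^ d : ℕ) : ℝ) * (5 : ℝ) ^ d)))) +
      (2 * (d : ℝ) + 2 * Real.log (2 * d + 1)) * 1 *
      (((max 1 (2 * 32 + 2) : ℕ) : ℝ) *
      ((2 * (((2 * cth 32 1 sS + 1) ^ d : ℕ) : ℝ) * ((((2 * 32 + 1) ^ d : ℕ) : ℝ) * (4 * 2 ^ d)) +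
      4 * ((((2 * cth 32 1 sS + 1) ^ d : ℕ) : ℝ) * (5 : ℝ) ^ d)) / (1 - θc)) +
      4 * 2 ^ d)) +
      10) + 8 * 2 ^ d * Real.log (2 * d + 1)
  refine ⟨min (min 1 (Real.exp (-(irThresholdTLE C F.L rr β₀) / 2))) (Real.exp (-((max 1 (Θ / (θ * C.A₀)) + 1) / 2))),
    lt_min (lt_min one_pos (Real.exp_pos _)) (Real.exp_pos _),
    fun g hg hgle => ⟨max (em g) 0, le_max_right _ _, fun g₀ ht => ?_⟩⟩
  have hir : irThresholdTLE C F.L rr β₀ ≤ Real.log (g ^ 2)⁻¹ :=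
    HistoryRealiseCellsRunPinned.le_log_inv_sq_of_le_exp hg ((hgle.trans (min_le_left _ _)).trans (min_le_right _ _))
  intro ι _ α π _ _ l₀ vol K₀ T A A' shA shB dead dead' nup mup Nup Cc Rr CcRec RrRec ν u s₂ q₀ r s Wsh obs B hobs hbd
    hα hα' c₀ n₁ hc₀ hfloor hfloor' hsites hsites' hNup hnup hmup R hR hR1 ped cellP liveC Zd H hstep hDJ hBB κ κ' hκ
    hκ' FcM RfM FcM' RfM' hPM hPM' upM deadM_nonneg resumM FM_nonneg upM' deadM'_nonneg resumM' FM'_nonneg hSh hTB hr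
    hu hs hs₂
  obtain ⟨hP1, hθJ, hP⟩ := HistoryFlowProfileLevel.thresholdPaid_of_coupling D h hA₀ hθ Θ hb.le hlo hhi
    (hγle.trans ((min_le_left _ _).trans hγf₀)) hγβ hSm hβhalf ht hg (hgle.trans (min_le_right _ _)) K₀
  exact hybridNE7_of_realisedDomainsRunW_printedT3bPDT D h hμ d n hκ₁ hE₀ hb.le hlo hhi
    (hγle.trans ((min_le_left _ _).trans hγf₀)) hγβ hSm (le_max_left _ _) (le_max_right _ _) hβhalf ht hir hP1 hP
    hsign hcor (hγle.trans (min_le_right _ _)) hobs hbd hα hα' hc₀ hfloor hfloor' hsites hsites' hNup hnup hmup R hR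
    (HistoryRealiseCellsRunPinned.four_le_L F) hn₁ hR1 ped cellP liveC Zd H hn hstep hDJ hBB hθ.le hslack hE₂ hE₃ hsS
    hsmall hθc0 hθc1 hθcs hθJ κ κ' hκ hκ' hPM hPM' upM deadM_nonneg resumM FM_nonneg upM' deadM'_nonneg resumM'
    FM'_nonneg hSh hTB hr hu hs hs₂

end Pinned

end

end Summit.QuantumFields.BalabanUV.T4Continuum.HistoryRealiseCellsRunPinnedT3bPWT
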